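import Mathlib.Analysis.Normed.Algebra.MatrixExponential
import Mathlib.Analysis.SpecialFunctions.Exponential
import Mathlib.Analysis.Calculus.BumpFunction.FiniteDimension
import Literature.Geometry.ComplexHyperbolic.UnitBallLieAlgebraTransferLogBound   -- (a2-A) p846541: `norm_conj_torusH_le_of_norm_conj_circle_exp_le`
import Literature.Geometry.ComplexHyperbolic.UnitBallRegularConjugationFlag      -- ★ `diagonal_circle_preserves` (the cell's torus token)
import HarnessLib

/-!
# The GROUP → ALGEBRA transfer: the regular orbital integral of `U(2,1)` near the centre IS a Lie-algebra orbital integral `lieOrbital μ f (torusH θ)` (ROAD «A6-IV» brick (a2-B))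

Topic `Geometry/ComplexHyperbolic`; namespace `Literature.Geometry.ComplexHyperbolic.BallModel`.  THEOREMS ONLY (no `def`, no instance, no notation, no axiom, no named fact, no `sorry`).
Cell `pub/hodgecm-mathlib`, ENGINE T1 (crux H413 = `stmt-HodgeConjecture-24833`); ROAD «A6-IV» (owner∕architect F0P3a-p05 (g15), DESIGN v2 93542b84b04a2b0a; SPEC fb65bd65775896a0 §(a2)
`orbital_eq_lieOrbital`); pen F0P3a-p02 (g14), 2026-09-01.

THE MATHEMATICS [WarnerHASSLG2, §8.4.1].  Let `Θ : M₃(ℂ) → E` be smooth with `u ↦ Θ(mat u)` compactly supported on `U(2,1)`, and `ζ ∈ S¹` (a central point).  For the torus element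
`d(θ) = ζ·diag(e^{iθ_k}) ∈ U(2,1)`: `mat(g·d(θ)·g⁻¹) = ζ·Ad(g)·exp(torusH θ) = ζ·exp(Ad(g)·torusH θ)` (§1: `exp(torusH θ) = diag(e^{iθ_k})`, `exp ∘ Ad(g) = Ad(g) ∘ exp`, `mat g⁻¹ = (mat g)⁻¹`).
By ★ (a2-A), `Θ(mat(g d(θ) g⁻¹)) ≠ 0 ⟹ ‖Ad(g) exp(torusH θ)‖ ≤ R ⟹ ‖Ad(g) torusH θ‖ ≤ C = 1∕4 + 2(R+1) + 8(R+1)²` for `|θ_k| ≤ 1∕4`, `R` = a bound of `‖mat ·‖` on the support.  Hence with a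
smooth cutoff `ψ = 1` on `‖X‖ ≤ C` (Mathlib `ContDiffBump` on the finite-dimensional space `M₃(ℂ)`), the AMBIENT, SMOOTH, COMPACTLY SUPPORTED `f(X) = ψ(X)·Θ(ζ·exp X)` satisfies
§2 **`f(Ad(g)·torusH θ) = Θ(mat(g·d(θ)·g⁻¹))` for ALL `g` and all `|θ_k| ≤ 1∕4`**, so §3 **`∫_G Θ(mat(g d(θ) g⁻¹)) dμ = lieOrbital μ f (torusH θ)`** — the regular orbital integral of the group near
the central point `ζ` is a Lie-algebra orbital integral of ONE test function `f ∈ C_c^∞(M₃(ℂ))`, to which (a1)(b·)(c·)(d·) apply.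
HONEST LABEL: HC_CM is proved only modulo the printed citations until rung 0 closes; pays nothing by itself.

* [WarnerHASSLG2] G. Warner, *Harmonic Analysis on Semi-Simple Lie Groups II* (1972), §8.4.1 (reduction of the invariant integral near a semisimple point to the Lie algebra of its centraliser).
* [Knapp2002] A. W. Knapp, *Lie Groups Beyond an Introduction*, 2nd ed. (2002), I §10 (1.83) (`Ad(g) exp X = exp(Ad(g) X)`).
-/

noncomputable section

open Matrix Complex MeasureTheory Set

open scoped Matrix.Norms.Operator ContDiff

namespace Literature.Geometry.ComplexHyperbolic

namespace BallModel

variable {E : Type*} [NormedAddCommGroup E] [NormedSpace ℝ E]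

/-! ### §1 `exp` on the conjugated torus -/

section Exp

/-- `mat g⁻¹ = (mat g)⁻¹` (matrix inverse). [cite: Knapp2002, I §10] -/
theorem mat_inv_eq_inv_mat (g : U21) : mat g⁻¹ = (mat g)⁻¹ := by
  have h : mat g * mat g⁻¹ = 1 := by rw [← mat_mul, mul_inv_cancel, mat_one]
  exact (Matrix.inv_eq_right_inv h).symm

/-- `exp(torusH θ) = diag(e^{iθ_k})`. [cite: Knapp2002, I §10] -/
theorem exp_torusH (θ : Fin 3 → ℝ) : NormedSpace.exp (torusH θ) = Matrix.diagonal (fun k => cexp ((θ k : ℂ) * I)) := by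
  rw [torusH, Matrix.exp_diagonal, Pi.exp_def, Complex.exp_eq_exp_ℂ]

/-- `exp(Ad(g) X) = Ad(g) exp X` for `g ∈ U(2,1)`. [cite: Knapp2002, I §10 (1.83)] -/
theorem exp_conj_mat (g : U21) (X : Matrix (Fin 3) (Fin 3) ℂ) : NormedSpace.exp (mat g * X * mat g⁻¹) = mat g * NormedSpace.exp X * mat g⁻¹ := by
  have hu : IsUnit (mat g) := (Matrix.isUnit_iff_isUnit_det _).2 (isUnit_iff_ne_zero.2 (det_mat_ne_zero g))
  rw [mat_inv_eq_inv_mat]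
  exact Matrix.exp_conj _ _ hu

/-- The torus token of the cell is `ζ • diag(e^{iθ})`. [cite: WarnerHASSLG2, §8.4.1] -/
theorem diagonal_circle_mul_exp_eq_smul (ζ : Circle) (θ : Fin 3 → ℝ) :
    Matrix.diagonal (fun i => ((ζ * Circle.exp (θ i) : Circle) : ℂ)) = (ζ : ℂ) • Matrix.diagonal (fun k => cexp ((θ k : ℂ) * I)) := by
  have hfun : (fun i => ((ζ * Circle.exp (θ i) : Circle) : ℂ)) = (ζ : ℂ) • fun k => cexp ((θ k : ℂ) * I) := by
    funext k
    simp [Circle.coe_exp]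
  rw [hfun, diagonal_smul]

/-- **`mat(g·d(θ)·g⁻¹) = ζ • exp(Ad(g)·torusH θ)`** for the torus element `d(θ) = ζ·diag(e^{iθ_k})`. [cite: Knapp2002, I §10 (1.83)] [cite: WarnerHASSLG2, §8.4.1] -/
theorem mat_conj_torus_eq_smul_exp (g : U21) (ζ : Circle) (θ : Fin 3 → ℝ) :
    mat (g * mkU21 (Matrix.diagonal fun i => ((ζ * Circle.exp (θ i) : Circle) : ℂ)) (diagonal_circle_preserves _) * g⁻¹) =
      (ζ : ℂ) • NormedSpace.exp (mat g * torusH θ * mat g⁻¹) := by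
  rw [mat_mul, mat_mul, mat_mkU21, diagonal_circle_mul_exp_eq_smul, exp_conj_mat, exp_torusH, Matrix.mul_smul, Matrix.smul_mul]

/-- The same identity read as a norm statement: `‖Ad(g)·diag(ζe^{iθ})‖ = ‖mat(g·d(θ)·g⁻¹)‖`. [cite: WarnerHASSLG2, §8.4.1] -/
theorem mat_conj_torus_eq_conj_diagonal (g : U21) (ζ : Circle) (θ : Fin 3 → ℝ) :
    mat (g * mkU21 (Matrix.diagonal fun i => ((ζ * Circle.exp (θ i) : Circle) : ℂ)) (diagonal_circle_preserves _) * g⁻¹) =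
      mat g * Matrix.diagonal (fun i => ((ζ * Circle.exp (θ i) : Circle) : ℂ)) * mat g⁻¹ := by
  rw [mat_mul, mat_mul, mat_mkU21]

/-- `X ↦ exp X` is real-smooth on `M₃(ℂ)` (entire). [cite: Knapp2002, I §10] -/
theorem contDiff_matrix_exp : ContDiff ℝ ∞ (fun X : Matrix (Fin 3) (Fin 3) ℂ => NormedSpace.exp X) := by
  have h : AnalyticOnNhd ℂ (fun X : Matrix (Fin 3) (Fin 3) ℂ => NormedSpace.exp X) Set.univ := fun x _ => NormedSpace.exp_analytic x
  exact h.contDiff.restrict_scalars ℝ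

end Exp

/-! ### §2 A support radius on the group and the cutoff -/

section Cutoff

omit [NormedSpace ℝ E] in
/-- Compact support ON THE GROUP gives one radius: `Θ(mat u) ≠ 0 ⟹ ‖mat u‖ ≤ R`. [cite: WarnerHASSLG2, §8.4.1] -/
theorem exists_norm_mat_le_of_hasCompactSupport (Θ : Matrix (Fin 3) (Fin 3) ℂ → E) (hΘc : HasCompactSupport (fun u : U21 => Θ (mat u))) :
    ∃ R : ℝ, 0 ≤ R ∧ ∀ u : U21, Θ (mat u) ≠ 0 → ‖mat u‖ ≤ R := by
  obtain ⟨C, hC⟩ := hΘc.isCompact.exists_bound_of_continuousOn (f := fun u : U21 => mat u) continuous_mat.continuousOn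
  refine ⟨max C 0, le_max_right _ _, fun u hu => (hC u (subset_tsupport _ (Function.mem_support.2 hu))).trans (le_max_left _ _)⟩

/-- A smooth compactly supported cutoff on `M₃(ℂ)` equal to `1` on the closed ball of radius `C` (Mathlib `ContDiffBump`, `M₃(ℂ)` finite-dimensional). [cite: WarnerHASSLG2, §8.4.1] -/
theorem exists_cutoff_eq_one (C : ℝ) (hC : 0 ≤ C) :
    ∃ ψ : Matrix (Fin 3) (Fin 3) ℂ → ℝ, ContDiff ℝ ∞ ψ ∧ HasCompactSupport ψ ∧ ∀ X, ‖X‖ ≤ C → ψ X = 1 := by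
  let b : ContDiffBump (0 : Matrix (Fin 3) (Fin 3) ℂ) := ⟨C + 1, C + 2, by linarith, by linarith⟩
  refine ⟨b, b.contDiff, b.hasCompactSupport, fun X hX => b.one_of_mem_closedBall ?_⟩
  rw [Metric.mem_closedBall, dist_zero_right]
  show ‖X‖ ≤ C + 1
  linarith

end Cutoff

/-! ### §3 The transfer -/

section Transfer

/-- **THE GROUP → ALGEBRA TRANSFER (pointwise and integrated).**  For `Θ : M₃(ℂ) → E` smooth with `u ↦ Θ(mat u)` compactly supported on `U(2,1)` and `ζ ∈ S¹` there is ONE ambient test function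
`f ∈ C_c^∞(M₃(ℂ))` (namely `ψ·Θ(ζ·exp ·)` with a cutoff `ψ`) such that for all `g ∈ U(2,1)` and all `θ` with `|θ_k| ≤ 1∕4`:
`f(Ad(g)·torusH θ) = Θ(mat(g·d(θ)·g⁻¹))`, `d(θ) = ζ·diag(e^{iθ_k})`; consequently `∫_G Θ(mat(g·d(θ)·g⁻¹)) dμ(g) = lieOrbital μ f (torusH θ)` for every measure `μ`.
[cite: WarnerHASSLG2, §8.4.1] [cite: Knapp2002, I §10 (1.83)] -/
theorem orbital_eq_lieOrbital (Θ : Matrix (Fin 3) (Fin 3) ℂ → E) (hΘ : ContDiff ℝ ∞ Θ) (hΘc : HasCompactSupport (fun u : U21 => Θ (mat u))) (ζ : Circle) :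
    ∃ f : Matrix (Fin 3) (Fin 3) ℂ → E, ContDiff ℝ ∞ f ∧ HasCompactSupport f ∧
      (∀ (g : U21) (θ : Fin 3 → ℝ), (∀ k, |θ k| ≤ 1 / 4) →
        f (mat g * torusH θ * mat g⁻¹) = Θ (mat (g * mkU21 (Matrix.diagonal fun i => ((ζ * Circle.exp (θ i) : Circle) : ℂ)) (diagonal_circle_preserves _) * g⁻¹))) ∧
      ∀ (μ : Measure U21) (θ : Fin 3 → ℝ), (∀ k, |θ k| ≤ 1 / 4) →
        ∫ g, Θ (mat (g * mkU21 (Matrix.diagonal fun i => ((ζ * Circle.exp (θ i) : Circle) : ℂ)) (diagonal_circle_preserves _) * g⁻¹)) ∂μ =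
          lieOrbital μ f (torusH θ) := by
  obtain ⟨R, hR0, hR⟩ := exists_norm_mat_le_of_hasCompactSupport Θ hΘc
  obtain ⟨ψ, hψ, hψc, hψ1⟩ := exists_cutoff_eq_one (1 / 4 + 2 * (R + 1) + 8 * (R + 1) ^ 2) (by positivity)
  set f : Matrix (Fin 3) (Fin 3) ℂ → E := fun X => ψ X • Θ ((ζ : ℂ) • NormedSpace.exp X) with hf
  have hfd : ContDiff ℝ ∞ f := hψ.smul (hΘ.comp (contDiff_matrix_exp.const_smul (ζ : ℂ)))
  have hfc : HasCompactSupport f := hψc.smul_right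
  have hpt : ∀ (g : U21) (θ : Fin 3 → ℝ), (∀ k, |θ k| ≤ 1 / 4) →
      f (mat g * torusH θ * mat g⁻¹) = Θ (mat (g * mkU21 (Matrix.diagonal fun i => ((ζ * Circle.exp (θ i) : Circle) : ℂ)) (diagonal_circle_preserves _) * g⁻¹)) := by
    intro g θ hθ
    simp only [hf]
    rw [← mat_conj_torus_eq_smul_exp]
    by_cases h0 : Θ (mat (g * mkU21 (Matrix.diagonal fun i => ((ζ * Circle.exp (θ i) : Circle) : ℂ)) (diagonal_circle_preserves _) * g⁻¹)) = 0
    · rw [h0, smul_zero]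
    · have hRg := hR _ h0
      rw [mat_conj_torus_eq_conj_diagonal] at hRg
      rw [hψ1 _ (norm_conj_torusH_le_of_norm_conj_circle_exp_le g θ hθ ζ hRg), one_smul]
  refine ⟨f, hfd, hfc, hpt, fun μ θ hθ => ?_⟩
  rw [lieOrbital]
  exact integral_congr_ae (Filter.Eventually.of_forall fun g => (hpt g θ hθ).symm)

end Transfer

end BallModel

end Literature.Geometry.ComplexHyperbolic

end
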